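import Literature.NumberTheory.GaloisRepresentations.LubinTateColemanCoordGaloisTwo
import Literature.NumberTheory.GaloisRepresentations.LubinTateColemanAdicFixedPoint
import Literature.NumberTheory.GaloisRepresentations.LubinTateColemanLogDerivLimit
import HarnessLib

/-!
# The `𝒪_F^×`-action on the Coleman coordinates is PRO-UNIPOTENT at `q = 2`: `r_{σ_v β} − r_β ∈ (π, Y)^{N+1}` for `r_β ∈ (π, Y)^N`
# (first step of the `Λ(𝒪_F^×)`-module structure of the coordinate module `𝒪⟦Y⟧` in the Lubin–Tate direction)

De Shalit, *Iwasawa theory of elliptic curves with complex multiplication* (1987), Ch. I §3.1 ("the Iwasawa algebra … `Λ ≅ ℤ_p⟦S⟧` …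
`Γ = 1 + 4ℤ₂` when `p = 2`") and §3.4 Lemma (ii) (`i` is a homomorphism of `ℤ_p⟦𝒢⟧`-modules): to let the COMPLETED group ring of
`G = Gal(K_π^∞/F) ≅ 𝒪_F^×` act on the coordinate module `{r_β} = 𝒪_F⟦Y⟧` of Theorem I.3.7 one needs the action
`v ⋆ r = v·ρ_v·(r ∘ [v]_f)` (`unitCoordTwo_unitAct`, `LubinTateColemanCoordGaloisTwo`) to be continuous, i.e. `(v⋆ − 1)` to be topologically
nilpotent for the `(π, Y)`-adic filtration `I_N` (`adicFilt`).  At `q = 2` EVERY unit `v` is `≡ 1 (mod π)` (`𝓀_F = 𝔽₂`), and this file proves: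

* ★ `LubinTate.subst_sub_self_mem_adicFiltGen_succ` (generic, any commutative `S`, `p ∈ S`): for `g ∈ S⟦X⟧` with `g(0) = 0` and `g′(0) ≡ 1 (mod p)`,
  **`r ∈ I_N ⟹ r ∘ g − r ∈ I_{N+1}`**; `LubinTate.subst_mem_adicFiltGen_of_mem` (`r ∘ g ∈ I_N`);
* `sub_one_mem_span_pi_of_isUnit_two` (`q = 2`: `v − 1 ∈ (π)` for every unit), `constantCoeff_evenPartTwo_unitTwistSerTwo` (`ρ_v(0) = 1`);
* ★★ `unitCoordTwo_unitAct_sub_mem_adicFilt_succ` — **`r_β ∈ I_N ⟹ r_{σ_v β} − r_β ∈ I_{N+1}`** for every `v ∈ 𝒪_F^×`: the action of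
  `𝒪_F^×` on the coordinates is pro-unipotent, so `T ↦ σ_γ − 1` (`γ` a topological generator of `1 + 4ℤ₂`) extends to a continuous
  `𝒪_F⟦T⟧`-module structure on `𝒪_F⟦Y⟧` (the extension itself — limits of `Σ c_k (σ_γ − 1)^k r` — is left to the sequel).

Everything PROVED (0 sorry, no named facts, no new definitions).

## References

* E. de Shalit, *Iwasawa theory of elliptic curves with complex multiplication* (1987), Ch. I §3.1, §3.4 Lemma (ii), §3.7. [deShalit1987]
-/

noncomputable section

open scoped PowerSeries.WithPiTopology

namespace Literature.NumberTheory.GaloisRepresentations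

/-! ### Generic: substitution by `g = X + (higher) + p(…)X` moves the `(p, X)`-filtration up by one on the difference -/

namespace LubinTate

section SubstUnipotent

variable {S : Type*} [CommRing S] {p : S} {g : PowerSeries S} (hg0 : PowerSeries.constantCoeff g = 0)
  (hg1 : PowerSeries.coeff 1 g - 1 ∈ Ideal.span {p})

/-- A series with constant term in `(p)` lies in `I_1`. [cite: deShalit1987, Ch. I §3.13 Lemma (proof)] -/
theorem mem_adicFiltGen_one_of_constantCoeff_mem {V : PowerSeries S} (h : PowerSeries.constantCoeff V ∈ Ideal.span {p}) :
    V ∈ adicFiltGen p 1 := by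
  intro k
  rcases Nat.eq_zero_or_pos k with rfl | hk
  · rwa [Nat.sub_zero, pow_one, PowerSeries.coeff_zero_eq_constantCoeff]
  · rw [show 1 - k = 0 by omega, pow_zero, Ideal.span_singleton_one]; exact Submodule.mem_top

include hg0 hg1 in
/-- ★ **`r ∈ I_N ⟹ r ∘ g − r ∈ I_{N+1}`** for `g(0) = 0`, `g′(0) ≡ 1 (mod p)`: writing `r = c + X·r′` and `g = X·w` (`w(0) = g′(0) ≡ 1`),
`r ∘ g − r = X·(w·(r′ ∘ g − r′) + (w − 1)·r′)` and induction on `N`. [cite: deShalit1987, Ch. I §3.13 Lemma (proof)] -/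
theorem subst_sub_self_mem_adicFiltGen_succ : ∀ (N : ℕ) {r : PowerSeries S}, r ∈ adicFiltGen p N →
    PowerSeries.subst g r - r ∈ adicFiltGen p (N + 1) := by
  have hgs : PowerSeries.HasSubst g := PowerSeries.HasSubst.of_constantCoeff_zero' hg0
  -- `g = X · w` with `w − 1 ∈ I_1`
  obtain ⟨w, hw⟩ : ∃ w : PowerSeries S, w = PowerSeries.mk fun i => PowerSeries.coeff (i + 1) g := ⟨_, rfl⟩
  have hgw : g = PowerSeries.X * w := by
    have e := PowerSeries.eq_X_mul_shift_add_const g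
    rw [hg0, map_zero, add_zero] at e
    rw [hw]; exact e
  have hw1 : w - 1 ∈ adicFiltGen p 1 := by
    refine mem_adicFiltGen_one_of_constantCoeff_mem ?_
    rw [map_sub, map_one, hw, ← PowerSeries.coeff_zero_eq_constantCoeff, PowerSeries.coeff_mk, Nat.zero_add]
    exact hg1
  intro N
  induction N with
  | zero =>
    intro r _
    refine mem_adicFiltGen_one_of_constantCoeff_eq_zero ?_
    rw [map_sub, constantCoeff_subst_eq hg0, sub_self]
  | succ N ih =>
    intro r hr
    obtain ⟨r', hr'⟩ : ∃ r' : PowerSeries S, r' = PowerSeries.mk fun i => PowerSeries.coeff (i + 1) r := ⟨_, rfl⟩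
    have hr'mem : r' ∈ adicFiltGen p N := by rw [hr']; simpa using shift_mem_adicFiltGen (p := p) hr
    have e : r = PowerSeries.X * r' + PowerSeries.C (PowerSeries.constantCoeff r) := by
      rw [hr']; exact PowerSeries.eq_X_mul_shift_add_const r
    have key : PowerSeries.subst g r - r = PowerSeries.X * (w * (PowerSeries.subst g r' - r') + (w - 1) * r') := by
      conv_lhs => rw [e]
      rw [PowerSeries.subst_add hgs, PowerSeries.subst_mul hgs, PowerSeries.subst_X hgs, PowerSeries.subst_C]
      change g * PowerSeries.subst g r' + PowerSeries.C (PowerSeries.constantCoeff r) -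
        (PowerSeries.X * r' + PowerSeries.C (PowerSeries.constantCoeff r)) = _
      rw [hgw]; ring
    rw [key]
    have h1 : w * (PowerSeries.subst g r' - r') + (w - 1) * r' ∈ adicFiltGen p (N + 1) := by
      refine add_mem ?_ ?_
      · have := mul_mem_adicFiltGen (mem_adicFiltGen_zero (p := p) w) (ih hr'mem)
        rwa [Nat.zero_add] at this
      · have := mul_mem_adicFiltGen hw1 hr'mem
        rwa [Nat.add_comm] at this
    have h2 := mul_mem_adicFiltGen (mem_adicFiltGen_one_of_constantCoeff_eq_zero (p := p) PowerSeries.constantCoeff_X) h1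
    rwa [show 1 + (N + 1) = N + 1 + 1 by ring] at h2

include hg0 hg1 in
/-- **`r ∈ I_N ⟹ r ∘ g ∈ I_N`** (same hypotheses). [cite: deShalit1987, Ch. I §3.13 Lemma (proof)] -/
theorem subst_mem_adicFiltGen_of_mem (N : ℕ) {r : PowerSeries S} (hr : r ∈ adicFiltGen p N) :
    PowerSeries.subst g r ∈ adicFiltGen p N := by
  have h := add_mem (adicFiltGen_mono (Nat.le_succ N) (subst_sub_self_mem_adicFiltGen_succ hg0 hg1 N hr)) hr
  rwa [sub_add_cancel] at h

end SubstUnipotent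

end LubinTate

/-! ### `q = 2`: the unit action on the coordinates is pro-unipotent -/

section CoordUnipotentTwo

open GaloisRepresentations.IsNonarchimedeanLocalField LubinTate ValuativeRel

variable {F : Type} [Field F] [ValuativeRel F] [TopologicalSpace F] [IsNonarchimedeanLocalField F]

attribute [local instance] ltNormUniformSpace ltNormIsUniformAddGroup rk1 nF nE fintypeResidueField

variable {π : 𝒪[F]} (hπ : (valuation F).IsUniformizer (π : F)) (hq : residueFieldCard F = 2)

include hπ hq in
/-- At `q = 2` every unit is `≡ 1 (mod π)` (`𝓀_F = 𝔽₂ = {0, 1}`). [cite: deShalit1987, Ch. I §3.1 (p = 2)] -/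
theorem sub_one_mem_span_pi_of_isUnit_two (v : 𝒪[F]ˣ) :
    LTCoeff.of F (v : 𝒪[F]) - 1 ∈ Ideal.span {LTCoeff.of F π} := by
  have h1 : (v : 𝒪[F]) - 1 ∈ 𝓂[F] := by
    rcases eq_zero_or_eq_one_two hq (IsLocalRing.residue 𝒪[F] (v : 𝒪[F])) with h | h
    · exact absurd ((IsLocalRing.residue_eq_zero_iff _).mp h) ((IsLocalRing.notMem_maximalIdeal).mpr v.isUnit)
    · refine (Ideal.Quotient.mk_eq_mk_iff_sub_mem _ _).mp ?_
      change IsLocalRing.residue 𝒪[F] (v : 𝒪[F]) = IsLocalRing.residue 𝒪[F] 1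
      rw [h, map_one]
  rw [maximalIdeal_eq_span_singleton hπ] at h1
  obtain ⟨c, hc⟩ := Ideal.mem_span_singleton'.mp h1
  refine Ideal.mem_span_singleton'.mpr ⟨LTCoeff.of F c, ?_⟩
  rw [← map_mul, hc, map_sub, map_one]

include hπ in
/-- **`ρ_v(0) = 1`**: the constant term of the twist `ρ_v` (from `(1 + tX)·(ρ_v ∘ f) = 1 + t[v]_f` at `X = 0`).
[cite: deShalit1987, Ch. I §3.4 Lemma (ii)] -/
theorem constantCoeff_evenPartTwo_unitTwistSerTwo {t : LTCoeff F} (ht : (2 : LTCoeff F) = LTCoeff.of F π * t) (v : 𝒪[F]ˣ) :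
    PowerSeries.constantCoeff (evenPartTwo hπ hq (unitTwistSerTwo hπ t v)) = 1 := by
  have h := congrArg PowerSeries.constantCoeff (one_add_mul_subst_evenPartTwo_unitTwistSerTwo hπ hq ht v)
  rw [map_mul, map_add, map_one, map_mul, PowerSeries.constantCoeff_C, PowerSeries.constantCoeff_X, mul_zero, add_zero, one_mul,
    constantCoeff_subst_eq (isLTSeries_ltSer π).constantCoeff_eq_zero, map_add, map_one, map_mul, PowerSeries.constantCoeff_C,
    constantCoeff_hom, mul_zero, add_zero] at h
  exact h

include hq in
/-- ★★ **The `𝒪_F^×`-action on the coordinates is pro-unipotent at `q = 2`**: if `r_β ∈ I_N = (π, Y)^N` then `r_{σ_v β} − r_β ∈ I_{N+1}` for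
EVERY unit `v` (`r_{σ_vβ} − r_β = (vρ_v − 1)·(r_β ∘ [v]) + (r_β ∘ [v] − r_β)`, `vρ_v − 1 ∈ I_1`, `r_β ∘ [v] − r_β ∈ I_{N+1}`).  Hence
`(σ_γ − 1)^k r → 0` and the action of `𝒪_F^× ∋ γ` extends to `𝒪_F⟦T⟧`, `T = σ_γ − 1` (sequel).
[cite: deShalit1987, Ch. I §3.4 Lemma (ii); §3.1] -/
theorem unitCoordTwo_unitAct_sub_mem_adicFilt_succ (u : (LTCoeff F)ˣ) (hu : LTCoeff.of F π = residueFieldCard F * u)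
    (v : 𝒪[F]ˣ) (β : NormCoherentUnits hπ) {N : ℕ} (hβ : unitCoordTwo hπ hq u β ∈ adicFilt π N) :
    unitCoordTwo hπ hq u (β.unitAct v) - unitCoordTwo hπ hq u β ∈ adicFilt π (N + 1) := by
  have ht := two_eq_of_mul_inv hq u hu
  -- currency: `adicFilt π = adicFiltGen (of π)` (same carrier)
  have hmem : ∀ {M : ℕ} {V : PowerSeries (LTCoeff F)}, V ∈ adicFilt π M ↔ V ∈ adicFiltGen (LTCoeff.of F π) M := Iff.rfl
  rw [hmem] at hβ ⊢
  obtain ⟨H, hH⟩ : ∃ H : PowerSeries (LTCoeff F),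
      H = hom (isLTRing_LTCoeff hπ) (isLTSeries_LTCoeff π) (isLTSeries_LTCoeff π) (LTCoeff.of F (v : 𝒪[F])) := ⟨_, rfl⟩
  have hH0 : PowerSeries.constantCoeff H = 0 := by rw [hH]; exact constantCoeff_hom _ _ _ _
  have hH1 : PowerSeries.coeff 1 H - 1 ∈ Ideal.span {LTCoeff.of F π} := by
    rw [hH, coeff_one_hom]; exact sub_one_mem_span_pi_of_isUnit_two hπ hq v
  obtain ⟨ρ, hρ⟩ : ∃ ρ : PowerSeries (LTCoeff F), ρ = evenPartTwo hπ hq (unitTwistSerTwo hπ (↑u⁻¹ : LTCoeff F) v) := ⟨_, rfl⟩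
  have hρ1 : PowerSeries.C (LTCoeff.of F (v : 𝒪[F])) * ρ - 1 ∈ adicFiltGen (LTCoeff.of F π) 1 := by
    refine mem_adicFiltGen_one_of_constantCoeff_mem ?_
    rw [map_sub, map_one, map_mul, PowerSeries.constantCoeff_C, hρ, constantCoeff_evenPartTwo_unitTwistSerTwo hπ hq ht, mul_one]
    exact sub_one_mem_span_pi_of_isUnit_two hπ hq v
  rw [unitCoordTwo_unitAct hπ hq u hu v β, ← hH, ← hρ]
  have e : PowerSeries.C (LTCoeff.of F (v : 𝒪[F])) * ρ * PowerSeries.subst H (unitCoordTwo hπ hq u β) - unitCoordTwo hπ hq u β =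
      (PowerSeries.C (LTCoeff.of F (v : 𝒪[F])) * ρ - 1) * PowerSeries.subst H (unitCoordTwo hπ hq u β) +
        (PowerSeries.subst H (unitCoordTwo hπ hq u β) - unitCoordTwo hπ hq u β) := by ring
  rw [e]
  refine add_mem ?_ (subst_sub_self_mem_adicFiltGen_succ hH0 hH1 N hβ)
  have h := mul_mem_adicFiltGen hρ1 (subst_mem_adicFiltGen_of_mem hH0 hH1 N hβ)
  rwa [Nat.add_comm] at h

/-- ★★ **The twist operator `r ↦ v·ρ_v·(r ∘ [v]_f) − r` raises the `(π, Y)`-filtration on ALL of `𝒪_F⟦Y⟧`** (not only on coordinates):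
`r ∈ I_N ⟹ v·ρ_v·(r ∘ [v]) − r ∈ I_{N+1}` for every unit `v` (`q = 2`) — the operator form needed to extend `T ↦ σ_γ − 1` to an
`𝒪_F⟦T⟧`-module structure on the whole coordinate module by `(π, Y)`-adic limits. [cite: deShalit1987, Ch. I §3.4 Lemma (ii); §3.1] -/
theorem twistOp_sub_self_mem_adicFilt_succ (u : (LTCoeff F)ˣ) (hu : LTCoeff.of F π = residueFieldCard F * u) (v : 𝒪[F]ˣ)
    {N : ℕ} {r : PowerSeries (LTCoeff F)} (hr : r ∈ adicFilt π N) :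
    PowerSeries.C (LTCoeff.of F (v : 𝒪[F])) * evenPartTwo hπ hq (unitTwistSerTwo hπ (↑u⁻¹ : LTCoeff F) v) *
        PowerSeries.subst (hom (isLTRing_LTCoeff hπ) (isLTSeries_LTCoeff π) (isLTSeries_LTCoeff π) (LTCoeff.of F (v : 𝒪[F]))) r - r ∈
      adicFilt π (N + 1) := by
  have ht := two_eq_of_mul_inv hq u hu
  have hmem : ∀ {M : ℕ} {V : PowerSeries (LTCoeff F)}, V ∈ adicFilt π M ↔ V ∈ adicFiltGen (LTCoeff.of F π) M := Iff.rfl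
  rw [hmem] at hr ⊢
  obtain ⟨H, hH⟩ : ∃ H : PowerSeries (LTCoeff F),
      H = hom (isLTRing_LTCoeff hπ) (isLTSeries_LTCoeff π) (isLTSeries_LTCoeff π) (LTCoeff.of F (v : 𝒪[F])) := ⟨_, rfl⟩
  have hH0 : PowerSeries.constantCoeff H = 0 := by rw [hH]; exact constantCoeff_hom _ _ _ _
  have hH1 : PowerSeries.coeff 1 H - 1 ∈ Ideal.span {LTCoeff.of F π} := by
    rw [hH, coeff_one_hom]; exact sub_one_mem_span_pi_of_isUnit_two hπ hq v
  obtain ⟨ρ, hρ⟩ : ∃ ρ : PowerSeries (LTCoeff F), ρ = evenPartTwo hπ hq (unitTwistSerTwo hπ (↑u⁻¹ : LTCoeff F) v) := ⟨_, rfl⟩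
  have hρ1 : PowerSeries.C (LTCoeff.of F (v : 𝒪[F])) * ρ - 1 ∈ adicFiltGen (LTCoeff.of F π) 1 := by
    refine mem_adicFiltGen_one_of_constantCoeff_mem ?_
    rw [map_sub, map_one, map_mul, PowerSeries.constantCoeff_C, hρ, constantCoeff_evenPartTwo_unitTwistSerTwo hπ hq ht, mul_one]
    exact sub_one_mem_span_pi_of_isUnit_two hπ hq v
  rw [← hH, ← hρ]
  have e : PowerSeries.C (LTCoeff.of F (v : 𝒪[F])) * ρ * PowerSeries.subst H r - r =
      (PowerSeries.C (LTCoeff.of F (v : 𝒪[F])) * ρ - 1) * PowerSeries.subst H r + (PowerSeries.subst H r - r) := by ring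
  rw [e]
  refine add_mem ?_ (subst_sub_self_mem_adicFiltGen_succ hH0 hH1 N hr)
  have h := mul_mem_adicFiltGen hρ1 (subst_mem_adicFiltGen_of_mem hH0 hH1 N hr)
  rwa [Nat.add_comm] at h

end CoordUnipotentTwo

end Literature.NumberTheory.GaloisRepresentations
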